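import Summits.NavierStokesRegularity.FunctionalMining.TopEigGapCoercivePow
import Summits.NavierStokesRegularity.FunctionalMining.TopEigGapCoerciveHigh
import Summits.NavierStokesRegularity.FunctionalMining.TopEigHeatCoerciveSymm
import Summits.NavierStokesRegularity.FunctionalMining.NoGo.NegBotEigAmplitudeFloor
import HarnessLib

/-!
# FunctionalMining — Proposition L-λ(η) for the `−λ₃` core: heat coercivity of `Ψ_q = ∫((−λ₃)⁺)^q`
# on the BOTTOM-gap class `(1 − η)λ₃ ≤ λ₂`, by the symmetry `v ↦ −v`

Search for candidate a priori estimates; no regularity claim. Cell `pub-nsfunc`, prove seat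
(gen 28). A finite statement about smooth divergence-free zero-mean fields on `T³` and the static heat
dissipation of the `−λ₃` moment; nothing about Navier–Stokes is proved or asserted.

THE POINT. The dictionary types Lemma L-λ for BOTH one-signed cores of K0 (`TopEigHeatCoercivePos q` for
`Φ_q = ∫(λ₁⁺)^q`, rows `ES.lam1.q | T_LD | G1`, and `NegBotEigHeatCoercivePos q` for `Ψ_q = ∫((−λ₃)⁺)^q`,
rows `ES.neglam3.q | T_LD | G1`; `TopEigHeatCoercive.lean`), and the two are EQUIVALENT rate by rate under
`v ↦ −v` (`negBotEigHeatCoercive_iff`, `TopEigHeatCoerciveSymm.lean`). Its partial positive result,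
Proposition L-λ(η) — coercivity on the top-gap class `λ₂ ≤ (1 − η)λ₁` (`StrainGapClass η`,
`TopEigGapCoercivePos q η`; KERNEL for `2 ≤ q ≤ 6` in `TopEigGapCoercivePow`, and for every real `q ≥ 2` in
`TopEigGapCoerciveHigh`) — and SIEVELD's COROLLARY ("if L-λ fails, violators are near-biaxial") were typed
for the `λ₁` core only. This file transports both to the `−λ₃` core. Under `v ↦ −v` the sorted strain
eigenvalues map as `(λ₁, λ₂, λ₃) ↦ (−λ₃, −λ₂, −λ₁)` (`torusStrainTopEig_neg`, `torusStrainBotEig_neg`, and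
here `torusStrainMidEig_neg`), so the top-gap class of `−v` is the BOTTOM-gap class of `v`,
`(1 − η)·λ₃(x) ≤ λ₂(x)` for all `x` (`strainGapClass_neg_iff`; `λ₃ ≤ 0`, at `η = 1` the class is `0 ≤ λ₂`),
while `Φ_q(−v) = Ψ_q(v)` and `heatDissipation Φ_q (−v) = heatDissipation Ψ_q v` (tree).

CONTENT (namespace `Summit.NavierStokesRegularity.FunctionalMining`; the bottom-gap class is written
inline as the predicate `fun v => ∀ x, (1 − η) * torusStrainBotEig v x ≤ torusStrainMidEig v x` — no new
definition):
* `sum_torusStrainEig_neg`, `torusStrainMidEig_neg` — `λ₂(−v) = −λ₂(v)` pointwise;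
* `strainGapClass_neg_iff` — `StrainGapClass η (−v) ↔ ∀ x, (1−η)λ₃(x) ≤ λ₂(x)`;
* `heatCoerciveOn_negBotEigMoment_botGap_iff` — for every real `q, η, c`: `Ψ_q` is heat-coercive at rate `c`
  on the bottom-gap class iff `Φ_q` is at rate `c` on the top-gap class (`TopEigHeatCoerciveOnGap q η c`);
* `negBotEigMoment_botGapCoercivePos_of_topGap` — `TopEigGapCoercivePos q η` ⇒ the same existential
  statement for `Ψ_q` on the bottom-gap class (every real `q, η`);
* **`negBotEigMoment_botGapCoercivePos_of_two_le (2 ≤ q) (q ≤ 6) (0 < η)`** — Proposition L-λ(η) for the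
  `−λ₃` core on `T³`, KERNEL, from the tree node `topEigGapCoercivePos_of_two_le`; the same proof with
  `TopEig.topEigGapCoercivePos_of_ge_two` (`TopEigGapCoerciveHigh`, p373324) removes `q ≤ 6` — left to a
  one-line sequel once that module's olean is on the farm;
* `exists_violator_outside_botGap`, **`violators_outside_botGap_of_not_pos`** — SIEVELD's COROLLARY for the
  `−λ₃` core: if `NegBotEigHeatCoercivePos q` FAILS (equivalently `TopEigHeatCoercivePos q` fails), then for
  every `η > 0` and every small rate there is an admissible field OUTSIDE the bottom-gap class — with a point
  where `λ₂ < (1 − η)λ₃`, i.e. near-biaxial of the second kind `λ₂ ≈ λ₃` — whose heat dissipation of `Ψ_q`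
  is below `c·Ψ_q`; unconditional for `2 ≤ q ≤ 6` here.
NOT CLAIMED: the one-sided nodes `TopEigHeatCoercivePos q` / `NegBotEigHeatCoercivePos q` (OPEN in the
kernel for every real `q > 1`), `q < 2`, any constant, Navier–Stokes regularity. [ours; symmetry bookkeeping
on top of the gen-26 kernel Proposition L-λ(η)]
-/

noncomputable section

open Finset MeasureTheory

namespace Summit.NavierStokesRegularity.FunctionalMining

open Literature.Analysis Literature.Analysis.FunctionSpaces Literature.Analysis.FunctionSpaces.Torus

variable {d : Type*} [Fintype d] [DecidableEq d]

/-! ## 1. The middle eigenvalue and the gap class under `v ↦ −v` -/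

/-- The sum of the sorted strain eigenvalues changes sign under `v ↦ −v`. [folklore, bookkeeping] -/
theorem sum_torusStrainEig_neg (v : UnitAddTorus d → EuclideanSpace ℝ d) (x : UnitAddTorus d) :
    ∑ k, torusStrainEig (-v) x k = -∑ k, torusStrainEig v x k := by
  simp_rw [torusStrainEig_neg]
  rw [Finset.sum_neg_distrib]
  congr 1
  exact Fintype.sum_bijective Fin.rev Fin.rev_involutive.bijective _ _ fun _ => rfl

/-- **`λ₂(−v) = −λ₂(v)` pointwise** (the middle of `(−λ₃, −λ₂, −λ₁)`; binder-free in `d`, junk-compatible,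
from `torusStrainTopEig_neg` / `torusStrainBotEig_neg`). [folklore] -/
theorem torusStrainMidEig_neg (v : UnitAddTorus d → EuclideanSpace ℝ d) (x : UnitAddTorus d) :
    torusStrainMidEig (-v) x = -torusStrainMidEig v x := by
  unfold torusStrainMidEig
  rw [sum_torusStrainEig_neg, torusStrainTopEig_neg, torusStrainBotEig_neg]
  ring

/-- **The top-gap class of `−v` is the bottom-gap class of `v`:**
`StrainGapClass η (−v) ↔ ∀ x, (1 − η)·λ₃(x) ≤ λ₂(x)`. [ours, bookkeeping] -/
theorem strainGapClass_neg_iff (η : ℝ) (v : UnitAddTorus d → EuclideanSpace ℝ d) :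
    StrainGapClass η (-v) ↔ ∀ x, (1 - η) * torusStrainBotEig v x ≤ torusStrainMidEig v x := by
  unfold StrainGapClass
  refine forall_congr' fun x => ?_
  rw [torusStrainMidEig_neg, torusStrainTopEig_neg]
  constructor <;> intro h <;> linarith

/-- The bottom-gap class of `−v` is the top-gap class of `v`. [ours, bookkeeping] -/
theorem botGapClass_neg_iff (η : ℝ) (v : UnitAddTorus d → EuclideanSpace ℝ d) :
    (∀ x, (1 - η) * torusStrainBotEig (-v) x ≤ torusStrainMidEig (-v) x) ↔ StrainGapClass η v := by
  rw [← strainGapClass_neg_iff, neg_neg]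

/-! ## 2. Transport of Proposition L-λ(η) to the `−λ₃` core -/

/-- **Rate by rate: `Ψ_q` is heat-coercive at rate `c` on the bottom-gap class iff `Φ_q` is at rate `c` on the
top-gap class** (every real `q, η, c`; smoothness, `div = 0`, zero mean and the heat dissipation are
`v ↦ −v`-invariant, `Φ_q(−v) = Ψ_q(v)`). [ours, bookkeeping] -/
theorem heatCoerciveOn_negBotEigMoment_botGap_iff (q η c : ℝ) :
    HeatCoerciveOn (fun v : UnitAddTorus d → EuclideanSpace ℝ d =>
        ∀ x, (1 - η) * torusStrainBotEig v x ≤ torusStrainMidEig v x) (torusNegBotEigMoment q) c ↔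
      TopEigHeatCoerciveOnGap (d := d) q η c := by
  constructor
  · intro h hd v hv hdiv hmean hP
    have h' := h hd (-v) hv.neg ((torus_isDivFree_neg_iff v).2 hdiv) ((torus_hasZeroMean_neg_iff v).2 hmean)
      ((botGapClass_neg_iff η v).2 hP)
    rwa [torusNegBotEigMoment_neg, heatDissipation_negBotEigMoment_neg] at h'
  · intro h hd v hv hdiv hmean hP
    have h' := h hd (-v) hv.neg ((torus_isDivFree_neg_iff v).2 hdiv) ((torus_hasZeroMean_neg_iff v).2 hmean)
      ((strainGapClass_neg_iff η v).2 hP)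
    rwa [torusTopEigMoment_neg, heatDissipation_topEigMoment_neg] at h'

/-- **Existential form:** the node `TopEigGapCoercivePos q η` hands Proposition L-λ(η) for the `−λ₃` core on
the bottom-gap class (every real `q, η`). [ours, bookkeeping] -/
theorem negBotEigMoment_botGapCoercivePos_of_topGap {q η : ℝ} (h : TopEigGapCoercivePos (d := d) q η) :
    ∃ c : ℝ, 0 < c ∧ HeatCoerciveOn (fun v : UnitAddTorus d → EuclideanSpace ℝ d =>
        ∀ x, (1 - η) * torusStrainBotEig v x ≤ torusStrainMidEig v x) (torusNegBotEigMoment q) c := by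
  obtain ⟨c, hc, hcoer⟩ := h
  exact ⟨c, hc, (heatCoerciveOn_negBotEigMoment_botGap_iff q η c).2 hcoer⟩

/-- **PROPOSITION L-λ(η) FOR THE `−λ₃` CORE ON `T³`, `2 ≤ q ≤ 6`, `η > 0`:** there is `c > 0` with
`c · Ψ_q(v) ≤ heatDissipation Ψ_q v` for every smooth, divergence-free, zero-mean `v` whose strain has the
bottom gap `(1 − η)λ₃ ≤ λ₂` at every point (the tree node `topEigGapCoercivePos_of_two_le` transported; with
`TopEig.topEigGapCoercivePos_of_ge_two` in place of it the ceiling `q ≤ 6` disappears). [ours] -/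
theorem negBotEigMoment_botGapCoercivePos_of_two_le {q η : ℝ} (hq : 2 ≤ q) (hq6 : q ≤ 6) (hη0 : 0 < η) :
    ∃ c : ℝ, 0 < c ∧ HeatCoerciveOn (fun v : UnitAddTorus (Fin 3) → EuclideanSpace ℝ (Fin 3) =>
        ∀ x, (1 - η) * torusStrainBotEig v x ≤ torusStrainMidEig v x) (torusNegBotEigMoment q) c :=
  negBotEigMoment_botGapCoercivePos_of_topGap (TopEig.topEigGapCoercivePos_of_two_le hq hq6 hη0)

/-! ## 3. SIEVELD's Corollary for the `−λ₃` core: violators are near-biaxial of the second kind -/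

/-- **COROLLARY, kernel form (pure logic).** If `Ψ_q` is heat-coercive at rate `c₀` on the bottom-gap class
and the `−λ₃` row FAILS at some rate `c ≤ c₀`, the failure is witnessed by a smooth zero-mean divergence-free
field OUTSIDE the class — one with a point where `λ₂ < (1 − η)λ₃` — whose heat dissipation of `Ψ_q` is below
`c·Ψ_q`. [ours, bookkeeping] -/
theorem exists_violator_outside_botGap {q η c₀ c : ℝ}
    (hgap : HeatCoerciveOn (fun v : UnitAddTorus d → EuclideanSpace ℝ d =>
        ∀ x, (1 - η) * torusStrainBotEig v x ≤ torusStrainMidEig v x) (torusNegBotEigMoment q) c₀)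
    (hnot : ¬ NegBotEigHeatCoercive (d := d) q c) (hc : c ≤ c₀) :
    ∃ v : UnitAddTorus d → EuclideanSpace ℝ d, Torus.IsSmooth v ∧ Torus.IsDivFree v ∧
      Torus.HasZeroMean v ∧ ¬ (∀ x, (1 - η) * torusStrainBotEig v x ≤ torusStrainMidEig v x) ∧
      heatDissipation (torusNegBotEigMoment q) v < c * torusNegBotEigMoment q v := by
  simp only [NegBotEigHeatCoercive, HeatCoercive, not_forall, not_le, exists_prop] at hnot
  obtain ⟨hd, v, hv, hdiv, hmean, hlt⟩ := hnot
  refine ⟨v, hv, hdiv, hmean, fun hP => ?_, hlt⟩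
  have h1 : c₀ * torusNegBotEigMoment q v ≤ heatDissipation (torusNegBotEigMoment q) v :=
    hgap hd v hv hdiv hmean hP
  have h2 : c * torusNegBotEigMoment q v ≤ c₀ * torusNegBotEigMoment q v :=
    mul_le_mul_of_nonneg_right hc (torusNegBotEigMoment_nonneg q v)
  linarith

/-- **The Corollary against the open node, every real `q, η`, from the `λ₁` gap node.** If
`TopEigGapCoercivePos q η` holds and the `−λ₃` row `NegBotEigHeatCoercivePos q` FAILS, then for every small
rate there is an admissible field outside the bottom-gap class `η` violating it. [ours, bookkeeping] -/
theorem violators_outside_botGap_of_topGap {q η : ℝ} (hgap : TopEigGapCoercivePos (d := d) q η)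
    (hfail : ¬ NegBotEigHeatCoercivePos (d := d) q) :
    ∃ c₀ : ℝ, 0 < c₀ ∧ ∀ c : ℝ, 0 < c → c ≤ c₀ →
      ∃ v : UnitAddTorus d → EuclideanSpace ℝ d, Torus.IsSmooth v ∧ Torus.IsDivFree v ∧
        Torus.HasZeroMean v ∧ ¬ (∀ x, (1 - η) * torusStrainBotEig v x ≤ torusStrainMidEig v x) ∧
        heatDissipation (torusNegBotEigMoment q) v < c * torusNegBotEigMoment q v := by
  obtain ⟨c₀, hc₀, hcoer⟩ := negBotEigMoment_botGapCoercivePos_of_topGap hgap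
  refine ⟨c₀, hc₀, fun c hc hcc₀ => exists_violator_outside_botGap hcoer ?_ hcc₀⟩
  intro h
  exact hfail ⟨c, hc, h⟩

/-- **SIEVELD's COROLLARY FOR THE `−λ₃` CORE, UNCONDITIONAL ON `T³` FOR `2 ≤ q ≤ 6`.** If the `−λ₃` row of
Lemma L-λ (`NegBotEigHeatCoercivePos q`, equivalently the `λ₁` row) FAILS, then for EVERY `η > 0` and every
small rate the violators live OUTSIDE the bottom-gap class `(1 − η)λ₃ ≤ λ₂`: a violating sequence develops
near-biaxial points of the second kind, `λ₂ ≈ λ₃`. [ours] -/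
theorem violators_outside_botGap_of_not_pos {q η : ℝ} (hq : 2 ≤ q) (hq6 : q ≤ 6) (hη0 : 0 < η)
    (hfail : ¬ NegBotEigHeatCoercivePos (d := Fin 3) q) :
    ∃ c₀ : ℝ, 0 < c₀ ∧ ∀ c : ℝ, 0 < c → c ≤ c₀ →
      ∃ v : UnitAddTorus (Fin 3) → EuclideanSpace ℝ (Fin 3), Torus.IsSmooth v ∧ Torus.IsDivFree v ∧
        Torus.HasZeroMean v ∧ ¬ (∀ x, (1 - η) * torusStrainBotEig v x ≤ torusStrainMidEig v x) ∧
        heatDissipation (torusNegBotEigMoment q) v < c * torusNegBotEigMoment q v :=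
  violators_outside_botGap_of_topGap (TopEig.topEigGapCoercivePos_of_two_le hq hq6 hη0) hfail

/-- The same corollary read against the `λ₁` row: if `TopEigHeatCoercivePos q` fails (`2 ≤ q ≤ 6`), violators
of the `−λ₃` row exist outside every bottom-gap class (`negBotEigHeatCoercivePos_iff`). [ours, bookkeeping] -/
theorem violators_outside_botGap_of_not_topPos {q η : ℝ} (hq : 2 ≤ q) (hq6 : q ≤ 6) (hη0 : 0 < η)
    (hfail : ¬ TopEigHeatCoercivePos (d := Fin 3) q) :
    ∃ c₀ : ℝ, 0 < c₀ ∧ ∀ c : ℝ, 0 < c → c ≤ c₀ →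
      ∃ v : UnitAddTorus (Fin 3) → EuclideanSpace ℝ (Fin 3), Torus.IsSmooth v ∧ Torus.IsDivFree v ∧
        Torus.HasZeroMean v ∧ ¬ (∀ x, (1 - η) * torusStrainBotEig v x ≤ torusStrainMidEig v x) ∧
        heatDissipation (torusNegBotEigMoment q) v < c * torusNegBotEigMoment q v :=
  violators_outside_botGap_of_not_pos hq hq6 hη0 (mt (negBotEigHeatCoercivePos_iff q).1 hfail)

/-! ## 4. Every real `q ≥ 2` (sequel: the ceiling `q ≤ 6` removed through `TopEigGapCoerciveHigh`) -/

/-- **PROPOSITION L-λ(η) FOR THE `−λ₃` CORE ON `T³` FOR EVERY REAL `q ≥ 2`, `η > 0`** (the gap node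
`TopEig.topEigGapCoercivePos_of_ge_two` of `TopEigGapCoerciveHigh` transported by `v ↦ −v`). [ours] -/
theorem negBotEigMoment_botGapCoercivePos_of_ge_two {q η : ℝ} (hq : 2 ≤ q) (hη0 : 0 < η) :
    ∃ c : ℝ, 0 < c ∧ HeatCoerciveOn (fun v : UnitAddTorus (Fin 3) → EuclideanSpace ℝ (Fin 3) =>
        ∀ x, (1 - η) * torusStrainBotEig v x ≤ torusStrainMidEig v x) (torusNegBotEigMoment q) c :=
  negBotEigMoment_botGapCoercivePos_of_topGap (TopEig.topEigGapCoercivePos_of_ge_two hq hη0)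

/-- **SIEVELD's COROLLARY FOR THE `−λ₃` CORE, UNCONDITIONAL ON `T³` FOR EVERY REAL `q ≥ 2`.** [ours] -/
theorem violators_outside_botGap_of_not_pos_of_ge_two {q η : ℝ} (hq : 2 ≤ q) (hη0 : 0 < η)
    (hfail : ¬ NegBotEigHeatCoercivePos (d := Fin 3) q) :
    ∃ c₀ : ℝ, 0 < c₀ ∧ ∀ c : ℝ, 0 < c → c ≤ c₀ →
      ∃ v : UnitAddTorus (Fin 3) → EuclideanSpace ℝ (Fin 3), Torus.IsSmooth v ∧ Torus.IsDivFree v ∧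
        Torus.HasZeroMean v ∧ ¬ (∀ x, (1 - η) * torusStrainBotEig v x ≤ torusStrainMidEig v x) ∧
        heatDissipation (torusNegBotEigMoment q) v < c * torusNegBotEigMoment q v :=
  violators_outside_botGap_of_topGap (TopEig.topEigGapCoercivePos_of_ge_two hq hη0) hfail

/-- The same read against the `λ₁` row, every real `q ≥ 2`. [ours, bookkeeping] -/
theorem violators_outside_botGap_of_not_topPos_of_ge_two {q η : ℝ} (hq : 2 ≤ q) (hη0 : 0 < η)
    (hfail : ¬ TopEigHeatCoercivePos (d := Fin 3) q) :
    ∃ c₀ : ℝ, 0 < c₀ ∧ ∀ c : ℝ, 0 < c → c ≤ c₀ →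
      ∃ v : UnitAddTorus (Fin 3) → EuclideanSpace ℝ (Fin 3), Torus.IsSmooth v ∧ Torus.IsDivFree v ∧
        Torus.HasZeroMean v ∧ ¬ (∀ x, (1 - η) * torusStrainBotEig v x ≤ torusStrainMidEig v x) ∧
        heatDissipation (torusNegBotEigMoment q) v < c * torusNegBotEigMoment q v :=
  violators_outside_botGap_of_not_pos_of_ge_two hq hη0 (mt (negBotEigHeatCoercivePos_iff q).1 hfail)

end Summit.NavierStokesRegularity.FunctionalMining

end
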